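import Literature.NumberTheory.Sieve.QuadraticRootsPrimeModuliDFILinear
import Literature.NumberTheory.Sieve.VaughanMeanValueDecomposition
import HarnessLib

/-!
# Duke–Friedlander–Iwaniec 1995, §7 (iii-a): the dyadic blocks of `R(w, y)` (PROVED)

Topic `Literature/NumberTheory/Sieve`.  Tools for the second deduction of §7 of W. Duke,
J. B. Friedlander, H. Iwaniec, Ann. of Math. 141 (1995), p. 438 — "(35) follows from
Proposition 2" — completed in `QuadraticRootsPrimeModuliDFIBilinear.lean`:

* short-interval divisor sums: `τ(k) ≤ 2 #{d ∣ k : d² ≤ k}`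
  (`DFI1995.card_divisors_le_two_mul_card_small`) and
  `∑_{X<k≤Z} τ(k) ≤ 2((Z − X)(1 + log Z) + √Z)` (`DFI1995.sum_Ioc_card_divisors_le_short`);
  `ω(m) ≤ 2 log m` (`DFI1995.cardDistinctFactors_le_two_mul_log`);
* **Proposition 2 on a block**: `|B(M, N')(α|_{(M,2M]}, β|_S)| ≤ K₂ ‖αρ‖ ‖β‖ (M^{1/2} + N'^{3/4}M^{3/8+ε'})`
  for `M, N' ≥ 1`, `S ⊆ (N', 2N']`, `β` on primes (`DFI1995.exists_norm_block_le`, from the named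
  fact `dukeFriedlanderIwaniec1995_proposition2` with `h ≤ hMN'`), the norms
  `‖α|_{(M,2M]}ρ‖ ≤ 2C_f log x (2M(1 + log x)³)^{1/2}` (`|α_m| ≤ ω(m) ≤ 2 log x`,
  `ρ(m) ≤ C_f τ(m)`, `∑_{m ≤ K} τ(m)² ≤ K(1 + log K)³`) and `‖β|_S‖ ≤ (#S)^{1/2}`, blocks with
  `M < 1` vanishing (`|α_1| ≤ ω(1) = 0`);
* **the main term of a fibre** `|T_S(X)| ≤ (2 log x + 1) K₂ 2C_f log x (X(1 + log x)³)^{1/2} (#S)^{1/2} ((X/2)^{1/2} + N'^{3/4}(X/2)^{3/8+ε'})`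
  (`DFI1995.norm_fiberSum_le`: `≤ log₂ x + 1` dyadic blocks, the cutoff below `1` is empty);
* **freeing the cutoff `mn ≤ x`** on a fibre `N_k ≤ n < N_{k+1} ≤ (1+Δ)N_k`: replacing `m ≤ x/n`
  by `m ≤ x/N_{k+1}` costs, for each prime `n`, `≤ 8C_f log x ((Δx/n + 1)(1 + log x) + √x)`
  (`DFI1995.norm_fiber_sub_fiberSum_le`; here the restriction of `β` to primes gives `τ(n) = 2`).

Everything in this file is proved.

## References

* W. Duke, J. B. Friedlander, H. Iwaniec, Ann. of Math. (2) 141 (1995), 423–441: Proposition 2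
  (p. 426, (10)), (33) and (35) (pp. 436–437), §7 (p. 438). [cite: DukeFriedlanderIwaniec1995, §7]
-/

namespace Literature.NumberTheory.Sieve

open scoped BigOperators Polynomial
open Filter Asymptotics Finset Polynomial

namespace DFI1995

/-! ### Divisor sums over short intervals -/

/-- `τ(k) ≤ 2 #{d ∣ k : d² ≤ k}` (the divisors `> √k` inject into those `≤ √k` by `d ↦ k/d`).
[folklore] -/
theorem card_divisors_le_two_mul_card_small {k : ℕ} (hk : k ≠ 0) :
    k.divisors.card ≤ 2 * (k.divisors.filter (fun d => d * d ≤ k)).card := by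
  set A := k.divisors.filter (fun d => d * d ≤ k) with hA
  set B := k.divisors.filter (fun d => ¬ d * d ≤ k) with hB
  have hsplit : k.divisors.card = A.card + B.card :=
    (Finset.card_filter_add_card_filter_not _).symm
  have hBA : B.card ≤ A.card := by
    refine Finset.card_le_card_of_injOn (fun d => k / d) (fun d hd => ?_) (fun d₁ hd₁ d₂ hd₂ heq => ?_)
    · rw [Finset.mem_coe, hB, Finset.mem_filter] at hd
      rw [Finset.mem_coe, hA, Finset.mem_filter]
      obtain ⟨hdiv, hlt⟩ := hd
      have hd' := Nat.mem_divisors.1 hdiv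
      refine ⟨Nat.mem_divisors.2 ⟨Nat.div_dvd_of_dvd hd'.1, hk⟩, ?_⟩
      have hlt' : k < d * d := not_le.1 hlt
      have hd0 : 0 < d := Nat.pos_of_ne_zero (by rintro rfl; simp at hlt')
      have h1 : k / d < d := (Nat.div_lt_iff_lt_mul hd0).2 hlt'
      calc k / d * (k / d) ≤ k / d * d := Nat.mul_le_mul_left _ h1.le
        _ ≤ k := Nat.div_mul_le_self k d
    · simp only [Finset.mem_coe, hB, Finset.mem_filter, Nat.mem_divisors] at hd₁ hd₂
      have h1 := Nat.div_mul_cancel hd₁.1.1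
      have h2 := Nat.div_mul_cancel hd₂.1.1
      have hq : k / d₁ ≠ 0 := by intro h0; rw [h0, zero_mul] at h1; exact hk h1.symm
      have heq' : k / d₁ = k / d₂ := heq
      have : k / d₁ * d₁ = k / d₁ * d₂ := by rw [h1, heq', h2]
      exact Nat.eq_of_mul_eq_mul_left (Nat.pos_of_ne_zero hq) this
  omega

/-- Multiples of `d` in `(X, Z]`: at most `(Z − X)/d + 1` of them. [folklore] -/
theorem card_Ioc_filter_dvd_le (X Z d : ℕ) (hd : 1 ≤ d) (hXZ : X ≤ Z) :
    (((Ioc X Z).filter (fun k => d ∣ k)).card : ℝ) ≤ ((Z - X : ℕ) : ℝ) / d + 1 := by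
  have hcard : ((Ioc X Z).filter (fun k => d ∣ k)).card = Z / d - X / d := by
    have h1 : (Ioc X Z).filter (fun k => d ∣ k) =
        (Ioc 0 Z).filter (fun k => d ∣ k) \ (Ioc 0 X).filter (fun k => d ∣ k) := by
      ext k
      simp only [Finset.mem_sdiff, Finset.mem_filter, Finset.mem_Ioc]
      constructor
      · rintro ⟨⟨h1, h2⟩, h3⟩; exact ⟨⟨⟨by omega, h2⟩, h3⟩, fun h => by omega⟩
      · rintro ⟨⟨⟨h1, h2⟩, h3⟩, h4⟩
        refine ⟨⟨?_, h2⟩, h3⟩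
        by_contra hle
        exact h4 ⟨⟨h1, not_lt.1 hle⟩, h3⟩
    rw [h1, Finset.card_sdiff_of_subset (fun k hk => by
      simp only [Finset.mem_filter, Finset.mem_Ioc] at hk ⊢
      exact ⟨⟨hk.1.1, hk.1.2.trans hXZ⟩, hk.2⟩)]
    rw [Nat.Ioc_filter_dvd_card_eq_div, Nat.Ioc_filter_dvd_card_eq_div]
  rw [hcard]
  have hd0 : (0 : ℝ) < d := by exact_mod_cast hd
  have hXd : (X : ℝ) / d < (X / d : ℕ) + 1 := by
    rw [div_lt_iff₀ hd0]
    have := Nat.lt_div_mul_add (a := X) (b := d) (by omega)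
    have : (X : ℝ) < ((X / d * d + d : ℕ) : ℝ) := by exact_mod_cast this
    push_cast at this
    linarith
  have hZd : ((Z / d : ℕ) : ℝ) ≤ (Z : ℝ) / d := Nat.cast_div_le
  have hmono : X / d ≤ Z / d := Nat.div_le_div_right hXZ
  rw [Nat.cast_sub hmono, Nat.cast_sub hXZ, sub_div]
  linarith

/-- **Divisor sum over a short interval**:
`∑_{X < k ≤ Z} τ(k) ≤ 2 ((Z − X)(1 + log Z) + √Z)`. [folklore] -/
theorem sum_Ioc_card_divisors_le_short (X Z : ℕ) (hXZ : X ≤ Z) :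
    ∑ k ∈ Ioc X Z, ((Nat.divisors k).card : ℝ) ≤
      2 * (((Z - X : ℕ) : ℝ) * (1 + Real.log Z) + Real.sqrt Z) := by
  set S : ℕ := Nat.sqrt Z with hS
  -- τ(k) ≤ 2 #{d ≤ √Z : d ∣ k}
  have h1 : ∀ k ∈ Ioc X Z, ((Nat.divisors k).card : ℝ) ≤
      2 * (((Icc 1 S).filter (fun d => d ∣ k)).card : ℝ) := by
    intro k hk
    rw [Finset.mem_Ioc] at hk
    have hk0 : k ≠ 0 := by omega
    have := card_divisors_le_two_mul_card_small hk0
    have hsub : k.divisors.filter (fun d => d * d ≤ k) ⊆ (Icc 1 S).filter (fun d => d ∣ k) := by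
      intro d hd
      simp only [Finset.mem_filter, Nat.mem_divisors, Finset.mem_Icc] at hd ⊢
      refine ⟨⟨Nat.pos_of_dvd_of_pos hd.1.1 (by omega), ?_⟩, hd.1.1⟩
      rw [hS, Nat.le_sqrt]
      exact hd.2.trans hk.2
    calc ((Nat.divisors k).card : ℝ) ≤ ((2 * (k.divisors.filter (fun d => d * d ≤ k)).card : ℕ) : ℝ) := by
          exact_mod_cast this
      _ ≤ ((2 * ((Icc 1 S).filter (fun d => d ∣ k)).card : ℕ) : ℝ) := by
          exact_mod_cast Nat.mul_le_mul_left 2 (Finset.card_le_card hsub)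
      _ = 2 * (((Icc 1 S).filter (fun d => d ∣ k)).card : ℝ) := by push_cast; ring
  -- double counting
  have h2 : ∑ k ∈ Ioc X Z, (((Icc 1 S).filter (fun d => d ∣ k)).card : ℝ) =
      ∑ d ∈ Icc 1 S, (((Ioc X Z).filter (fun k => d ∣ k)).card : ℝ) := by
    simp only [Finset.card_filter, Nat.cast_sum, Nat.cast_ite, Nat.cast_one, Nat.cast_zero]
    exact Finset.sum_comm
  calc ∑ k ∈ Ioc X Z, ((Nat.divisors k).card : ℝ)
      ≤ ∑ k ∈ Ioc X Z, 2 * (((Icc 1 S).filter (fun d => d ∣ k)).card : ℝ) := Finset.sum_le_sum h1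
    _ = 2 * ∑ d ∈ Icc 1 S, (((Ioc X Z).filter (fun k => d ∣ k)).card : ℝ) := by
        rw [← Finset.mul_sum, h2]
    _ ≤ 2 * ∑ d ∈ Icc 1 S, (((Z - X : ℕ) : ℝ) / d + 1) := by
        gcongr with d hd
        exact card_Ioc_filter_dvd_le X Z d (Finset.mem_Icc.1 hd).1 hXZ
    _ = 2 * (((Z - X : ℕ) : ℝ) * ∑ d ∈ Icc 1 S, ((d : ℝ))⁻¹ + S) := by
        rw [Finset.sum_add_distrib, Finset.sum_const, Nat.card_Icc, Finset.mul_sum]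
        simp [div_eq_mul_inv]
    _ ≤ 2 * (((Z - X : ℕ) : ℝ) * (1 + Real.log S) + S) := by
        gcongr
        have := Vaughan.sum_Ioc_inv_le S
        rwa [Vaughan.Ioc_zero_eq_Icc_one] at this
    _ ≤ 2 * (((Z - X : ℕ) : ℝ) * (1 + Real.log Z) + Real.sqrt Z) := by
        have hlog : Real.log S ≤ Real.log Z := by
          rcases Nat.eq_zero_or_pos S with h0 | hpos
          · rw [h0, Nat.cast_zero, Real.log_zero]
            exact Real.log_natCast_nonneg Z
          · exact Real.log_le_log (by exact_mod_cast hpos) (by exact_mod_cast Nat.sqrt_le_self Z)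
        have hsq : (S : ℝ) ≤ Real.sqrt Z := by rw [hS]; exact Real.nat_sqrt_le_real_sqrt
        have hZX : (0 : ℝ) ≤ ((Z - X : ℕ) : ℝ) := Nat.cast_nonneg _
        nlinarith

/-! ### `ω(m) ≤ 2 log m` -/

/-- `ω(m) = #primeFactors(m)`. [folklore] -/
theorem cardDistinctFactors_eq_card_primeFactors (m : ℕ) :
    ArithmeticFunction.cardDistinctFactors m = m.primeFactors.card := by
  rw [ArithmeticFunction.cardDistinctFactors_apply, ← List.card_toFinset]
  rfl

/-- `ω(m) ≤ 2 log m` for `m ≥ 1` (from `2^{ω(m)} ≤ τ(m) ≤ m`). [folklore] -/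
theorem cardDistinctFactors_le_two_mul_log {m : ℕ} (hm : 1 ≤ m) :
    (ArithmeticFunction.cardDistinctFactors m : ℝ) ≤ 2 * Real.log m := by
  have hm0 : m ≠ 0 := by omega
  have h2 : 2 ^ m.primeFactors.card ≤ m :=
    (GoldbachSeries.two_pow_card_primeFactors_le_card_divisors hm0).trans (Nat.card_divisors_le_self m)
  rw [cardDistinctFactors_eq_card_primeFactors]
  set w := m.primeFactors.card
  have hpow : (2 : ℝ) ^ w ≤ m := by exact_mod_cast h2
  have hlog : (w : ℝ) * Real.log 2 ≤ Real.log m := by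
    rw [← Real.log_pow]; exact Real.log_le_log (by positivity) hpow
  have hlog2 : (1 / 2 : ℝ) < Real.log 2 := by
    have := Real.log_two_gt_d9; linarith
  have hlogm : 0 ≤ Real.log m := Real.log_natCast_nonneg m
  nlinarith

/-! ### Bounding the dyadic blocks by Proposition 2 -/

/-- **Proposition 2, packaged for the blocks**: for `f = aX² + 2bX + c` (`ac > b²`), `h ≥ 1`,
`ε' > 0` there is `K₂ ≥ 0` with
`|B(M, N')(α|_{(M,2M]}, β|_S)| ≤ K₂ ‖αρ‖ ‖β‖ (M^{1/2} + N'^{3/4} M^{3/8+ε'})` whenever `M, N' ≥ 1`,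
`S ⊆ (N', 2N']` and `β` is supported on primes (from (10) with `h ≤ h M N'`). [folklore] -/
theorem exists_norm_block_le (H2 : dukeFriedlanderIwaniec1995_proposition2) {a b c : ℤ}
    (hD : 0 < a * c - b ^ 2) {h : ℕ} (hh : 1 ≤ h) {ε' : ℝ} (hε' : 0 < ε') :
    ∃ K₂ : ℝ, 0 ≤ K₂ ∧ ∀ M N' : ℝ, 1 ≤ M → 1 ≤ N' → ∀ (α β : ℕ → ℂ) (S : Finset ℕ),
      (∀ n ∈ S, N' < (n : ℝ) ∧ (n : ℝ) ≤ 2 * N') → (∀ n : ℕ, ¬ n.Prime → β n = 0) →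
      ‖bilinearForm (quad a b c) h (blockAlpha α M) (fiberBeta β S) M N'‖ ≤
        K₂ * normAlphaRho (quad a b c) (blockAlpha α M) M * l2Norm (fiberBeta β S) N' *
          (M ^ (1 / 2 : ℝ) + N' ^ (3 / 4 : ℝ) * M ^ (3 / 8 + ε')) := by
  obtain ⟨K, hK⟩ := H2 a b c hD ε' hε' h (by exact_mod_cast hh)
  refine ⟨max K 0, le_max_right _ _, fun M N' hM hN' α β S hS hβ => ?_⟩
  have hhMN : (h : ℝ) ≤ h * M * N' := by
    have h1 : (1 : ℝ) ≤ M * N' := one_le_mul_of_one_le_of_one_le hM hN'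
    have h0 : (0 : ℝ) ≤ h := Nat.cast_nonneg _
    nlinarith
  have hb := hK h hh M N' hM hN' hhMN (blockAlpha α M) (fiberBeta β S)
    (fun m hm => blockAlpha_ne_zero hm)
    (fun n hn => by
      obtain ⟨hnS, hβn⟩ := fiberBeta_ne_zero hn
      refine ⟨(hS n hnS).1, (hS n hnS).2, ?_⟩
      by_contra hp
      exact hβn (hβ n hp))
  have h1 : 0 ≤ normAlphaRho (quad a b c) (blockAlpha α M) M := by unfold normAlphaRho; positivity
  have h2 : 0 ≤ l2Norm (fiberBeta β S) N' := by unfold l2Norm; positivity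
  have h3 : 0 ≤ M ^ (1 / 2 : ℝ) + N' ^ (3 / 4 : ℝ) * M ^ (3 / 8 + ε') := by positivity
  exact hb.trans (mul_le_mul_of_nonneg_right (mul_le_mul_of_nonneg_right
    (mul_le_mul_of_nonneg_right (le_max_left _ _) h1) h2) h3)

/-- `‖α|_{(M,2M]} ρ‖ ≤ 2 C_f log x · (2M (1 + log x)³)^{1/2}` when `|α_m| ≤ ω(m)`, `2M ≤ x`
(`ω(m) ≤ 2 log m`, `ρ(m) ≤ C_f τ(m)`, `∑_{m ≤ K} τ(m)² ≤ K (1 + log K)³`). [folklore] -/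
theorem normAlphaRho_blockAlpha_le {f : ℤ[X]} {C : ℝ} (hC : 0 ≤ C)
    (hρ : ∀ n : ℕ, 1 ≤ n → ‖polyRootWeylSum f n 0‖ ≤ C * (Nat.divisors n).card)
    {α : ℕ → ℂ} (hα : ∀ m : ℕ, ‖α m‖ ≤ ArithmeticFunction.cardDistinctFactors m)
    {M x : ℝ} (hM : 0 ≤ M) (hMx : 2 * M ≤ x) (hx : 1 ≤ x) :
    normAlphaRho f (blockAlpha α M) M ≤
      2 * C * Real.log x * Real.sqrt (2 * M * (1 + Real.log x) ^ 3) := by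
  unfold normAlphaRho
  have hlx : 0 ≤ Real.log x := Real.log_nonneg hx
  have hterm : ∀ m ∈ Icc 1 ⌊2 * M⌋₊, ‖blockAlpha α M m‖ ^ 2 * (polyRootCountMod ![f] m : ℝ) ^ 2 ≤
      (2 * Real.log x) ^ 2 * (C * (Nat.divisors m).card) ^ 2 := by
    intro m hm
    obtain ⟨hm1, hm2⟩ := Finset.mem_Icc.1 hm
    have hmx : (m : ℝ) ≤ x := le_trans (le_trans (by exact_mod_cast hm2) (Nat.floor_le (by linarith))) hMx
    have hω : ‖blockAlpha α M m‖ ≤ 2 * Real.log x := by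
      refine (norm_blockAlpha_le α M m).trans ((hα m).trans ?_)
      refine (cardDistinctFactors_le_two_mul_log hm1).trans ?_
      have := Real.log_le_log (by exact_mod_cast hm1) hmx
      linarith
    have hρm : (polyRootCountMod ![f] m : ℝ) ≤ C * (Nat.divisors m).card := by
      have := hρ m hm1
      rwa [polyRootWeylSum_zero_right, Complex.norm_natCast] at this
    have h0 : 0 ≤ ‖blockAlpha α M m‖ := norm_nonneg _
    have h0' : (0 : ℝ) ≤ polyRootCountMod ![f] m := Nat.cast_nonneg _
    calc ‖blockAlpha α M m‖ ^ 2 * (polyRootCountMod ![f] m : ℝ) ^ 2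
        ≤ (2 * Real.log x) ^ 2 * (polyRootCountMod ![f] m : ℝ) ^ 2 := by gcongr
      _ ≤ (2 * Real.log x) ^ 2 * (C * (Nat.divisors m).card) ^ 2 := by gcongr
  have hsum : ∑ m ∈ Icc 1 ⌊2 * M⌋₊, ‖blockAlpha α M m‖ ^ 2 * (polyRootCountMod ![f] m : ℝ) ^ 2 ≤
      (2 * Real.log x) ^ 2 * C ^ 2 * (2 * M * (1 + Real.log x) ^ 3) := by
    refine (Finset.sum_le_sum hterm).trans ?_
    have h1 : ∑ m ∈ Icc 1 ⌊2 * M⌋₊, (2 * Real.log x) ^ 2 * (C * ((Nat.divisors m).card : ℝ)) ^ 2 =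
        (2 * Real.log x) ^ 2 * C ^ 2 * ∑ m ∈ Icc 1 ⌊2 * M⌋₊, ((Nat.divisors m).card : ℝ) ^ 2 := by
      rw [Finset.mul_sum]; exact Finset.sum_congr rfl fun m _ => by ring
    rw [h1]
    refine mul_le_mul_of_nonneg_left ?_ (by positivity)
    have h2 := Vaughan.sum_sq_card_divisors_le ⌊2 * M⌋₊
    rw [Vaughan.Ioc_zero_eq_Icc_one] at h2
    have h2' : ∑ m ∈ Icc 1 ⌊2 * M⌋₊, ((Nat.divisors m).card : ℝ) ^ 2 ≤
        ⌊2 * M⌋₊ * (1 + Real.log ⌊2 * M⌋₊) ^ 3 := by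
      refine le_trans (le_of_eq (Finset.sum_congr rfl fun m _ => by ring)) h2
    refine h2'.trans ?_
    have hfl : (⌊2 * M⌋₊ : ℝ) ≤ 2 * M := Nat.floor_le (by linarith)
    have hlog : Real.log (⌊2 * M⌋₊ : ℝ) ≤ Real.log x := by
      rcases Nat.eq_zero_or_pos ⌊2 * M⌋₊ with h0 | hpos
      · rw [h0, Nat.cast_zero, Real.log_zero]; exact hlx
      · exact Real.log_le_log (by exact_mod_cast hpos) (hfl.trans hMx)
    have hl0 : 0 ≤ Real.log (⌊2 * M⌋₊ : ℝ) := Real.log_natCast_nonneg _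
    have : (1 + Real.log (⌊2 * M⌋₊ : ℝ)) ^ 3 ≤ (1 + Real.log x) ^ 3 := by gcongr
    calc (⌊2 * M⌋₊ : ℝ) * (1 + Real.log ⌊2 * M⌋₊) ^ 3 ≤ (2 * M) * (1 + Real.log x) ^ 3 := by
          gcongr
      _ = 2 * M * (1 + Real.log x) ^ 3 := by ring
  calc Real.sqrt (∑ m ∈ Icc 1 ⌊2 * M⌋₊, ‖blockAlpha α M m‖ ^ 2 * (polyRootCountMod ![f] m : ℝ) ^ 2)
      ≤ Real.sqrt ((2 * Real.log x) ^ 2 * C ^ 2 * (2 * M * (1 + Real.log x) ^ 3)) :=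
        Real.sqrt_le_sqrt hsum
    _ = 2 * C * Real.log x * Real.sqrt (2 * M * (1 + Real.log x) ^ 3) := by
        rw [Real.sqrt_mul (by positivity), Real.sqrt_mul (by positivity),
          Real.sqrt_sq (by positivity), Real.sqrt_sq hC]
        ring

/-- `‖β|_S‖ ≤ (#S)^{1/2}` when `|β_n| ≤ 1`. [folklore] -/
theorem l2Norm_fiberBeta_le {β : ℕ → ℂ} (hβ : ∀ n : ℕ, ‖β n‖ ≤ 1) (S : Finset ℕ) (N' : ℝ) :
    l2Norm (fiberBeta β S) N' ≤ Real.sqrt S.card := by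
  unfold l2Norm
  refine Real.sqrt_le_sqrt ?_
  calc ∑ n ∈ Icc 1 ⌊2 * N'⌋₊, ‖fiberBeta β S n‖ ^ 2
      ≤ ∑ n ∈ Icc 1 ⌊2 * N'⌋₊, (if n ∈ S then (1 : ℝ) else 0) := by
        refine Finset.sum_le_sum fun n _ => ?_
        unfold fiberBeta
        split_ifs with h
        · have := hβ n
          have h0 := norm_nonneg (β n)
          nlinarith
        · simp
    _ = ((Icc 1 ⌊2 * N'⌋₊).filter (fun n => n ∈ S)).card := by
        rw [Finset.sum_boole]
    _ ≤ S.card := by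
        exact_mod_cast Finset.card_le_card (fun n hn => (Finset.mem_filter.1 hn).2)

/-- Blocks with `M < 1` vanish: they only see `m = 1`, and `|α_1| ≤ ω(1) = 0`. [folklore] -/
theorem bilinearForm_blockAlpha_eq_zero_of_lt_one (f : ℤ[X]) (h : ℤ) {α : ℕ → ℂ}
    (hα : ∀ m : ℕ, ‖α m‖ ≤ ArithmeticFunction.cardDistinctFactors m) (β' : ℕ → ℂ) {M : ℝ}
    (hM : 0 ≤ M) (hM1 : M < 1) (N' : ℝ) :
    bilinearForm f h (blockAlpha α M) β' M N' = 0 := by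
  unfold bilinearForm
  refine Finset.sum_eq_zero fun m hm => ?_
  have hm2 : m ≤ ⌊2 * M⌋₊ := (Finset.mem_Icc.1 hm).2
  have hm1 : 1 ≤ m := (Finset.mem_Icc.1 hm).1
  have hfl : ⌊2 * M⌋₊ ≤ 1 := by
    have : ⌊2 * M⌋₊ < 2 := (Nat.floor_lt (by linarith)).2 (by push_cast; linarith)
    omega
  have hm_eq : m = 1 := by omega
  have hα1 : α 1 = 0 := by
    have := hα 1
    rw [ArithmeticFunction.cardDistinctFactors_one, Nat.cast_zero] at this
    exact norm_le_zero_iff.1 this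
  have hb : blockAlpha α M m = 0 := by
    unfold blockAlpha
    rw [hm_eq]; split_ifs <;> simp [hα1]
  refine Finset.sum_eq_zero fun n _ => ?_
  rw [hb]; ring

/-- **The main term of one fibre**: `|T_S(X)| ≤ (2 log x + 1) · K₂ · 2C log x (X(1+log x)³)^{1/2}
· (#S)^{1/2} · ((X/2)^{1/2} + N'^{3/4} (X/2)^{3/8+ε'})` — dyadic blocks, each bounded by
Proposition 2 (blocks below `1` vanish), at most `log₂ x + 1` of them. [folklore] -/
theorem norm_fiberSum_le {f : ℤ[X]} {h : ℤ} {C K₂ ε' N' X x : ℝ} {α β : ℕ → ℂ} {S : Finset ℕ}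
    (hC : 0 ≤ C) (hK₂ : 0 ≤ K₂) (hε' : 0 ≤ ε')
    (hρ0 : ∀ n : ℕ, 1 ≤ n → ‖polyRootWeylSum f n 0‖ ≤ C * (Nat.divisors n).card)
    (hα : ∀ m : ℕ, ‖α m‖ ≤ ArithmeticFunction.cardDistinctFactors m) (hβ : ∀ n : ℕ, ‖β n‖ ≤ 1)
    (hS : S ⊆ Icc 1 ⌊2 * N'⌋₊)
    (hblock : ∀ M : ℝ, 1 ≤ M →
      ‖bilinearForm f h (blockAlpha α M) (fiberBeta β S) M N'‖ ≤
        K₂ * normAlphaRho f (blockAlpha α M) M * l2Norm (fiberBeta β S) N' *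
          (M ^ (1 / 2 : ℝ) + N' ^ (3 / 4 : ℝ) * M ^ (3 / 8 + ε')))
    (hN' : 0 ≤ N') (hX0 : 0 ≤ X) (hXx : X ≤ x) (hx : 1 ≤ x) :
    ‖fiberSum f h α β S X‖ ≤
      (2 * Real.log x + 1) * (K₂ * (2 * C * Real.log x * Real.sqrt (X * (1 + Real.log x) ^ 3)) *
        Real.sqrt S.card * ((X / 2) ^ (1 / 2 : ℝ) + N' ^ (3 / 4 : ℝ) * (X / 2) ^ (3 / 8 + ε'))) := by
  set J : ℕ := Nat.log 2 ⌊X⌋₊ + 1 with hJ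
  have hlx : 0 ≤ Real.log x := Real.log_nonneg hx
  -- the leftover vanishes
  have hleft : fiberSum f h α β S (X / 2 ^ J) = 0 := by
    refine fiberSum_eq_zero_of_lt_one f h α β S ?_
    rw [div_lt_one (by positivity)]
    have h1 : ⌊X⌋₊ < 2 ^ J := by
      rw [hJ]; exact Nat.lt_pow_succ_log_self one_lt_two _
    calc X < (⌊X⌋₊ : ℝ) + 1 := Nat.lt_floor_add_one X
      _ ≤ ((2 ^ J : ℕ) : ℝ) := by exact_mod_cast h1
      _ = 2 ^ J := by push_cast; ring
  -- the number of blocks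
  have hJle : (J : ℝ) ≤ 2 * Real.log x + 1 := by
    rw [hJ]; push_cast
    rcases lt_or_ge X 1 with hX1 | hX1
    · have : ⌊X⌋₊ = 0 := Nat.floor_eq_zero.2 hX1
      rw [this, Nat.log_zero_right]; push_cast; linarith
    · have h1 := natLog_two_floor_le hX1
      have h2 : Real.log X ≤ Real.log x := Real.log_le_log (by linarith) hXx
      linarith
  -- each block
  set G : ℝ := K₂ * (2 * C * Real.log x * Real.sqrt (X * (1 + Real.log x) ^ 3)) *
    Real.sqrt S.card * ((X / 2) ^ (1 / 2 : ℝ) + N' ^ (3 / 4 : ℝ) * (X / 2) ^ (3 / 8 + ε')) with hG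
  have hG0 : 0 ≤ G := by rw [hG]; positivity
  have hblockj : ∀ j ∈ Finset.range J,
      ‖fiberSum f h α β S (2 * (X / 2 ^ (j + 1))) - fiberSum f h α β S (X / 2 ^ (j + 1))‖ ≤ G := by
    intro j _
    set M : ℝ := X / 2 ^ (j + 1) with hM
    have hM0 : 0 ≤ M := by positivity
    have hMX : M ≤ X / 2 :=
      div_le_div_of_nonneg_left hX0 (by norm_num) (by
        calc (2 : ℝ) = 2 ^ (0 + 1) := by norm_num
          _ ≤ 2 ^ (j + 1) := pow_le_pow_right₀ (by norm_num) (by omega))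
    have h2MX : 2 * M ≤ X := by linarith
    rw [fiberSum_two_mul_sub f h α β hS hM0]
    rcases lt_or_ge M 1 with hM1 | hM1
    · rw [bilinearForm_blockAlpha_eq_zero_of_lt_one f h hα _ hM0 hM1, norm_zero]
      exact hG0
    · have hnAR : normAlphaRho f (blockAlpha α M) M ≤
          2 * C * Real.log x * Real.sqrt (X * (1 + Real.log x) ^ 3) := by
        refine (normAlphaRho_blockAlpha_le hC hρ0 hα hM0 (h2MX.trans hXx) hx).trans ?_
        refine mul_le_mul_of_nonneg_left (Real.sqrt_le_sqrt ?_) (by positivity)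
        have : 0 ≤ (1 + Real.log x) ^ 3 := by positivity
        nlinarith
      have hl2 := l2Norm_fiberBeta_le hβ S N'
      have hP : M ^ (1 / 2 : ℝ) + N' ^ (3 / 4 : ℝ) * M ^ (3 / 8 + ε') ≤
          (X / 2) ^ (1 / 2 : ℝ) + N' ^ (3 / 4 : ℝ) * (X / 2) ^ (3 / 8 + ε') := by
        have h1 : M ^ (1 / 2 : ℝ) ≤ (X / 2) ^ (1 / 2 : ℝ) := Real.rpow_le_rpow hM0 hMX (by norm_num)
        have h2 : M ^ (3 / 8 + ε') ≤ (X / 2) ^ (3 / 8 + ε') := Real.rpow_le_rpow hM0 hMX (by linarith)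
        have h3 : (0 : ℝ) ≤ N' ^ (3 / 4 : ℝ) := Real.rpow_nonneg hN' _
        nlinarith [mul_le_mul_of_nonneg_left h2 h3]
      have hl20 : 0 ≤ l2Norm (fiberBeta β S) N' := by unfold l2Norm; positivity
      have hnAR0 : 0 ≤ normAlphaRho f (blockAlpha α M) M := by unfold normAlphaRho; positivity
      have hP0 : 0 ≤ M ^ (1 / 2 : ℝ) + N' ^ (3 / 4 : ℝ) * M ^ (3 / 8 + ε') := by positivity
      calc ‖bilinearForm f h (blockAlpha α M) (fiberBeta β S) M N'‖
          ≤ K₂ * normAlphaRho f (blockAlpha α M) M * l2Norm (fiberBeta β S) N' *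
              (M ^ (1 / 2 : ℝ) + N' ^ (3 / 4 : ℝ) * M ^ (3 / 8 + ε')) := hblock M hM1
        _ ≤ G := by
          rw [hG]
          apply mul_le_mul _ hP hP0 (by positivity)
          exact mul_le_mul (mul_le_mul_of_nonneg_left hnAR hK₂) hl2 hl20 (by positivity)
  -- assemble
  rw [fiberSum_eq_dyadic f h α β S X J, hleft, zero_add]
  calc ‖∑ j ∈ Finset.range J, (fiberSum f h α β S (2 * (X / 2 ^ (j + 1))) -
        fiberSum f h α β S (X / 2 ^ (j + 1)))‖
      ≤ ∑ j ∈ Finset.range J, ‖fiberSum f h α β S (2 * (X / 2 ^ (j + 1))) -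
        fiberSum f h α β S (X / 2 ^ (j + 1))‖ := norm_sum_le _ _
    _ ≤ ∑ j ∈ Finset.range J, G := Finset.sum_le_sum hblockj
    _ = J * G := by rw [Finset.sum_const, Finset.card_range, nsmul_eq_mul]
    _ ≤ (2 * Real.log x + 1) * G := mul_le_mul_of_nonneg_right hJle hG0

/-! ### Freeing the cutoff `mn ≤ x` on a short interval of `n` -/

/-- On a fibre `N_k ≤ n < N_{k+1} ≤ (1+Δ) N_k`, replacing the cutoff `m ≤ x/n` by the fixed
`m ≤ x/N_{k+1}` costs, for each prime `n`, a divisor sum over an interval of length `≤ Δx/n + 1`: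
`≤ 8 C log x ((Δx/n + 1)(1 + log x) + √x)`. [folklore] -/
theorem norm_fiber_sub_fiberSum_le {f : ℤ[X]} {h : ℤ} {C x Δ Nk Nk1 : ℝ} {α β : ℕ → ℂ}
    {S : Finset ℕ} (hC : 0 ≤ C)
    (hρ : ∀ n : ℕ, 1 ≤ n → ‖polyRootWeylSum f n h‖ ≤ C * (Nat.divisors n).card)
    (hα : ∀ m : ℕ, ‖α m‖ ≤ ArithmeticFunction.cardDistinctFactors m) (hβ : ∀ n : ℕ, ‖β n‖ ≤ 1)
    (hβp : ∀ n : ℕ, ¬ n.Prime → β n = 0) (hx : 1 ≤ x) (hΔ : 0 ≤ Δ) (hNk : 0 < Nk)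
    (hNk1 : Nk1 ≤ (1 + Δ) * Nk)
    (hS : ∀ n ∈ S, 1 ≤ n ∧ (n : ℝ) ≤ x ∧ Nk ≤ (n : ℝ) ∧ (n : ℝ) < Nk1) :
    ‖(∑ n ∈ S, β n * ∑ m ∈ (Icc 1 (⌊x⌋₊ / n)).filter (fun m : ℕ => Nat.Coprime m n),
        α m * polyRootWeylSum f (m * n) h) - fiberSum f h α β S (x / Nk1)‖ ≤
      ∑ n ∈ S, 8 * C * Real.log x * ((Δ * x / n + 1) * (1 + Real.log x) + Real.sqrt x) := by
  have hlx : 0 ≤ Real.log x := Real.log_nonneg hx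
  have hx0 : 0 < x := by linarith
  unfold fiberSum
  rw [← Finset.sum_sub_distrib]
  refine (norm_sum_le _ _).trans (Finset.sum_le_sum fun n hn => ?_)
  obtain ⟨hn1, hnx, hNkn, hnNk1⟩ := hS n hn
  have hn0 : (0 : ℝ) < n := by exact_mod_cast hn1
  have hNk10 : 0 < Nk1 := lt_of_lt_of_le (lt_of_lt_of_le hNk hNkn) hnNk1.le
  set T₁ : ℕ := ⌊x⌋₊ / n with hT₁
  set T₀ : ℕ := ⌊x / Nk1⌋₊ with hT₀
  have hT₀T₁ : T₀ ≤ T₁ := by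
    rw [hT₁, ← Nat.floor_div_natCast]
    exact Nat.floor_mono (div_le_div_of_nonneg_left hx0.le hn0 hnNk1.le)
  -- the difference of the two inner sums is the sum over `T₀ < m ≤ T₁`
  have hsplit : (∑ m ∈ (Icc 1 T₁).filter (fun m : ℕ => Nat.Coprime m n),
        α m * polyRootWeylSum f (m * n) h) -
      (∑ m ∈ (Icc 1 T₀).filter (fun m : ℕ => Nat.Coprime m n),
        α m * polyRootWeylSum f (m * n) h) =
      ∑ m ∈ (Ioc T₀ T₁).filter (fun m : ℕ => Nat.Coprime m n),
        α m * polyRootWeylSum f (m * n) h := by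
    have hunion : (Icc 1 T₁).filter (fun m : ℕ => Nat.Coprime m n) =
        (Icc 1 T₀).filter (fun m : ℕ => Nat.Coprime m n) ∪
          (Ioc T₀ T₁).filter (fun m : ℕ => Nat.Coprime m n) := by
      rw [← Finset.filter_union]
      congr 1
      ext m; simp only [Finset.mem_union, Finset.mem_Icc, Finset.mem_Ioc]; omega
    have hdisj : Disjoint ((Icc 1 T₀).filter (fun m : ℕ => Nat.Coprime m n))
        ((Ioc T₀ T₁).filter (fun m : ℕ => Nat.Coprime m n)) := by
      refine Finset.disjoint_filter_filter ?_
      rw [Finset.disjoint_left]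
      intro m h1 h2
      rw [Finset.mem_Icc] at h1; rw [Finset.mem_Ioc] at h2; omega
    rw [hunion, Finset.sum_union hdisj]; ring
  rw [← mul_sub, hsplit, norm_mul]
  -- bound the short sum
  have hshort : ‖∑ m ∈ (Ioc T₀ T₁).filter (fun m : ℕ => Nat.Coprime m n),
      α m * polyRootWeylSum f (m * n) h‖ ≤
      2 * Real.log x * C * (Nat.divisors n).card * ∑ m ∈ Ioc T₀ T₁, ((Nat.divisors m).card : ℝ) := by
    calc ‖∑ m ∈ (Ioc T₀ T₁).filter (fun m : ℕ => Nat.Coprime m n), α m * polyRootWeylSum f (m * n) h‖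
        ≤ ∑ m ∈ (Ioc T₀ T₁).filter (fun m : ℕ => Nat.Coprime m n), ‖α m * polyRootWeylSum f (m * n) h‖ :=
          norm_sum_le _ _
      _ ≤ ∑ m ∈ Ioc T₀ T₁, ‖α m * polyRootWeylSum f (m * n) h‖ :=
          Finset.sum_le_sum_of_subset_of_nonneg (Finset.filter_subset _ _) fun _ _ _ => norm_nonneg _
      _ ≤ ∑ m ∈ Ioc T₀ T₁, 2 * Real.log x * C * (Nat.divisors n).card * ((Nat.divisors m).card : ℝ) := by
          refine Finset.sum_le_sum fun m hm => ?_
          have hm1 : 1 ≤ m := by have := (Finset.mem_Ioc.1 hm).1; omega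
          have hmx : (m : ℝ) ≤ x := by
            have h1 : m ≤ T₁ := (Finset.mem_Ioc.1 hm).2
            have h2 : T₁ ≤ ⌊x⌋₊ := Nat.div_le_self _ _
            exact le_trans (by exact_mod_cast h1.trans h2) (Nat.floor_le hx0.le)
          rw [norm_mul]
          have hαm : ‖α m‖ ≤ 2 * Real.log x := by
            refine (hα m).trans ((cardDistinctFactors_le_two_mul_log hm1).trans ?_)
            have := Real.log_le_log (by exact_mod_cast hm1) hmx
            linarith
          have hρmn : ‖polyRootWeylSum f (m * n) h‖ ≤ C * ((Nat.divisors n).card * (Nat.divisors m).card) := by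
            refine (hρ (m * n) (Nat.one_le_iff_ne_zero.2 (Nat.mul_ne_zero (by omega) (by omega)))).trans ?_
            refine mul_le_mul_of_nonneg_left ?_ hC
            rw [mul_comm ((Nat.divisors n).card : ℝ)]
            exact_mod_cast Vaughan.card_divisors_mul_le m n
          calc ‖α m‖ * ‖polyRootWeylSum f (m * n) h‖
              ≤ (2 * Real.log x) * (C * ((Nat.divisors n).card * (Nat.divisors m).card)) :=
                mul_le_mul hαm hρmn (norm_nonneg _) (by positivity)
            _ = 2 * Real.log x * C * (Nat.divisors n).card * ((Nat.divisors m).card : ℝ) := by ring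
      _ = 2 * Real.log x * C * (Nat.divisors n).card * ∑ m ∈ Ioc T₀ T₁, ((Nat.divisors m).card : ℝ) := by
          rw [Finset.mul_sum]
  -- the length of the short interval
  have hlen : ((T₁ - T₀ : ℕ) : ℝ) ≤ Δ * x / n + 1 := by
    rw [Nat.cast_sub hT₀T₁]
    have h1 : (T₁ : ℝ) ≤ x / n := by
      rw [hT₁]
      calc ((⌊x⌋₊ / n : ℕ) : ℝ) ≤ (⌊x⌋₊ : ℝ) / n := Nat.cast_div_le
        _ ≤ x / n := by gcongr; exact Nat.floor_le hx0.le
    have h2 : x / Nk1 - 1 < (T₀ : ℝ) := by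
      rw [hT₀]; have := Nat.lt_floor_add_one (x / Nk1); linarith
    have h3 : x / n - x / Nk1 ≤ Δ * x / n := by
      rw [div_sub_div _ _ hn0.ne' hNk10.ne', div_le_div_iff₀ (by positivity) hn0]
      have : x * Nk1 - (n : ℝ) * x = x * (Nk1 - n) := by ring
      rw [this]
      have h4 : Nk1 - n ≤ Δ * Nk := by linarith
      have h5 : x * (Nk1 - n) * n ≤ x * (Δ * Nk) * n := by gcongr
      have h6 : x * (Δ * Nk) * n ≤ Δ * x * (n * Nk1) := by
        have : Nk ≤ Nk1 := by linarith
        have : x * Δ * n * Nk ≤ x * Δ * n * Nk1 := by gcongr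
        nlinarith
      linarith
    linarith
  have hdivsum := sum_Ioc_card_divisors_le_short T₀ T₁ hT₀T₁
  have hT₁x : (T₁ : ℝ) ≤ x := le_trans (by exact_mod_cast Nat.div_le_self _ _) (Nat.floor_le hx0.le)
  have hlogT₁ : Real.log T₁ ≤ Real.log x := by
    rcases Nat.eq_zero_or_pos T₁ with h0 | hpos
    · rw [h0, Nat.cast_zero, Real.log_zero]; exact hlx
    · exact Real.log_le_log (by exact_mod_cast hpos) hT₁x
  have hsqrtT₁ : Real.sqrt T₁ ≤ Real.sqrt x := Real.sqrt_le_sqrt hT₁x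
  -- combine; `τ(n) ≤ 2` since `β n = 0` unless `n` is prime
  by_cases hp : n.Prime
  · have hτn : ((Nat.divisors n).card : ℝ) = 2 := by
      rw [Nat.Prime.divisors hp, Finset.card_pair hp.one_lt.ne]; norm_num
    rw [hτn] at hshort
    have hβn := hβ n
    have h0T : (0 : ℝ) ≤ ((T₁ - T₀ : ℕ) : ℝ) := Nat.cast_nonneg _
    calc ‖β n‖ * ‖∑ m ∈ (Ioc T₀ T₁).filter (fun m : ℕ => Nat.Coprime m n), α m * polyRootWeylSum f (m * n) h‖
        ≤ 1 * (2 * Real.log x * C * 2 * ∑ m ∈ Ioc T₀ T₁, ((Nat.divisors m).card : ℝ)) :=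
          mul_le_mul hβn hshort (norm_nonneg _) zero_le_one
      _ ≤ 1 * (2 * Real.log x * C * 2 * (2 * (((T₁ - T₀ : ℕ) : ℝ) * (1 + Real.log T₁) + Real.sqrt T₁))) := by
          gcongr
      _ ≤ 1 * (2 * Real.log x * C * 2 * (2 * ((Δ * x / n + 1) * (1 + Real.log x) + Real.sqrt x))) := by
          have hl1 : 0 ≤ 1 + Real.log (T₁ : ℝ) := by
            have := Real.log_natCast_nonneg T₁; linarith
          gcongr
      _ = 8 * C * Real.log x * ((Δ * x / n + 1) * (1 + Real.log x) + Real.sqrt x) := by ring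
  · rw [hβp n hp, norm_zero, zero_mul]
    positivity

end DFI1995

end Literature.NumberTheory.Sieve
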